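import Summits.QuantumFields.BalabanUV.Beta.GraphPoissonKernel

/-!
# `Summit.QuantumFields.BalabanUV.Beta.GraphGreenFunction` — the DIRICHLET GREEN'S FUNCTION of the free weighted graph Laplacian on a
# finite set carrying a unit supersolution: the Dirichlet solution with interior source, `green B x z`, the LAST-EXIT representation of
# the Poisson kernel `poisson B x y = Σ_{z∈B} green B x z·(Nδ_y)(z)`, SYMMETRY `green B x z = green B z x`, positivity and COMPARISON with
# supersolutions — the generic half of road P3's kernel proof of the harmonic-measure bound (HMB) in d = 4 (generic bond structure)

HONEST FRAMING (page 1 of everything in this cell).  Discharging `FlowStep.BetaPertH` would make Bałaban's ultraviolet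
stability UNCONDITIONAL — a constructive-QFT result; it is NOT the continuum limit and NOT the Clay problem.  This module
discharges nothing of `BetaPertH`; it is [folklore] finite-dimensional linear algebra and order bookkeeping on a finite bond structure,
kernel-checked, by CO-OWNER #3 of binder row D4 (unit `b2b-balaban-beta-d4-p3`, road P3 «reduction road», gen 12).  HONEST DEPENDENCY:
continuum YM on T⁴ ⇐ BetaPertH ∧ nine spine estimates (0/9 proved); BetaPertH ⇐ (D1) ∧ (D4) ∧ CAP+tail; G-an2-4 gates asym, D1 and NE2/3/4.

THE POINT.  After `GraphHarmonicExtension` ∕ `GraphPoissonKernel` ∕ `MeanValueFromPoisson` ∕ `TorusBallMeanValue` ∕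
`MeanValueBinderOfPoissonBound`, O.2 item (ii-b) for the MODEL is ONE pointwise bound on the Poisson kernel of a lattice ball seen from
its centre (HMB).  The classical proof bounds the GREEN'S FUNCTION with pole at the centre by an explicit supersolution and passes to the
Poisson kernel by the last-exit decomposition and symmetry (Lawler–Limic 2010, Lemma 6.3.6 p. 130: `H_A(x,y) = Σ_{z∈A} G_A(x,z)p(z,y)`).
THIS FILE supplies these generic tools on any finite bond structure `src, tgt : Bd → St` with weights `c` (`W`, `N` written out as in
files 12∕14) and any finite `B` carrying a nonnegative unit supersolution `w₀`:
* §1 the DIRICHLET SOLUTION WITH INTERIOR SOURCE **`dirSol B f`** (`W·u − Nu = f` on `B`, `u = 0` off `B`; existence by `dirSys`'s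
  surjectivity, `dirSol_unique`, finite linearity `dirSol_sum`);
* §2 the GREEN'S FUNCTION **`green B x z := dirSol B δ_z x`**: `green_nonneg`, **`green_le_of_supersolution`** (COMPARISON: any `w ≥ 0`
  off `B` with `W·w − Nw ≥ δ_z` on `B` dominates `green B · z`), `green_eq_zero_of_not_mem` (exterior poles);
* §3 **`poisson_eq_sum_green`** — LAST EXIT: `poisson B x y = Σ_{z∈B} green B x z · (Nδ_y)(z)` for `x ∈ B`, `y ∉ B` (the harmonic
  extension of `δ_y`, cut off outside `B`, is the Dirichlet solution with source `Nδ_y`);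
* §4 **`green_symm`** — SYMMETRY `green B x z = green B z x` from the symmetry of the Laplacian's bilinear form (`sum_mul_lap_comm`:
  `Σ_x u(x)·(W·v − Nv)(x) = Σ_x (W·u − Nu)(x)·v(x)`, reindexing the neighbour sums over the bonds).
NOT here: any explicit supersolution or estimate (the lattice Newton potential for d = 4 is the sibling `LatticeNewtonPotentialD4`).
LOCATORS (shape only; ABSOLUTE RULE): [Balaban1985BackgroundPropagators] p. 394 (`Ω₀Δ′Ω₀`, `G′`), Thm 3.1 (3.42) p. 397.  Row D4: NO class
change (critical-path width 0; D4 DISCHARGE NO DATE); NOT BetaPertH, NOT continuum, NOT Clay, NOT summit progress. -/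

open scoped BigOperators
open Finset

namespace Summit.QuantumFields.BalabanUV.Beta.GraphGreenFunction

open Summit.QuantumFields.BalabanUV.Beta.SubsolutionMeanValue (nb_sub nb_smul nb_mono nb_nonneg)
open Summit.QuantumFields.BalabanUV.Beta.GraphHarmonicExtension
open Summit.QuantumFields.BalabanUV.Beta.GraphPoissonKernel

noncomputable section

variable {St Bd : Type} [Fintype St] [Fintype Bd] [DecidableEq St] (src tgt : Bd → St) (c : Bd → ℝ)

/-! ## §1 The Dirichlet solution with interior source -/

open Classical in
/-- **The DIRICHLET SOLUTION with interior source `f`**: the function vanishing off `B` with `W·u − Nu = f` on `B` when one exists (it does,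
uniquely, when `B` carries a nonnegative unit supersolution), else `0`. MODEL object. [folklore] -/
def dirSol (B : Finset St) (f : St → ℝ) : St → ℝ :=
  if h : ∃ u : St → ℝ, (∀ x, x ∉ B → u x = 0) ∧
      ∀ x ∈ B, ((∑ b ∈ univ.filter (fun b => tgt b = x), c b ^ 2) + ∑ b ∈ univ.filter (fun b => src b = x), c b ^ 2) * u x -
        ((∑ b ∈ univ.filter (fun b => tgt b = x), c b ^ 2 * u (src b)) + ∑ b ∈ univ.filter (fun b => src b = x), c b ^ 2 * u (tgt b))
          = f x
    then h.choose else 0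

section Sol

variable (B : Finset St) (w₀ : St → ℝ) (hw₀0 : ∀ y, 0 ≤ w₀ y)
    (hw₀ : ∀ x ∈ B, 1 + ((∑ b ∈ univ.filter (fun b => tgt b = x), c b ^ 2 * w₀ (src b)) +
        ∑ b ∈ univ.filter (fun b => src b = x), c b ^ 2 * w₀ (tgt b)) ≤
      ((∑ b ∈ univ.filter (fun b => tgt b = x), c b ^ 2) + ∑ b ∈ univ.filter (fun b => src b = x), c b ^ 2) * w₀ x)

include hw₀0 hw₀

/-- Existence of the Dirichlet solution with interior source (`dirSys` is surjective). [folklore] -/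
theorem exists_dirSol (f : St → ℝ) : ∃ u : St → ℝ, (∀ x, x ∉ B → u x = 0) ∧
    ∀ x ∈ B, ((∑ b ∈ univ.filter (fun b => tgt b = x), c b ^ 2) + ∑ b ∈ univ.filter (fun b => src b = x), c b ^ 2) * u x -
      ((∑ b ∈ univ.filter (fun b => tgt b = x), c b ^ 2 * u (src b)) + ∑ b ∈ univ.filter (fun b => src b = x), c b ^ 2 * u (tgt b))
        = f x := by
  obtain ⟨u, hu⟩ := dirSys_surjective src tgt c B w₀ hw₀0 hw₀ (fun x => if x ∈ B then f x else 0)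
  refine ⟨u, fun x hx => ?_, fun x hx => ?_⟩
  · have h := congrFun hu x
    rw [dirSys_apply, if_neg hx] at h
    simp only [hx, if_false] at h
    exact h
  · have h := congrFun hu x
    rw [dirSys_apply, if_pos hx] at h
    simp only [hx, if_true] at h
    exact h

/-- `dirSol B f = 0` off `B`. [folklore] -/
theorem dirSol_eq_off (f : St → ℝ) (x : St) (hx : x ∉ B) : dirSol src tgt c B f x = 0 := by
  have hex := exists_dirSol src tgt c B w₀ hw₀0 hw₀ f
  rw [dirSol, dif_pos hex]
  exact hex.choose_spec.1 x hx

/-- `W·(dirSol B f) − N(dirSol B f) = f` on `B`. [folklore] -/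
theorem dirSol_eq_on (f : St → ℝ) (x : St) (hx : x ∈ B) :
    ((∑ b ∈ univ.filter (fun b => tgt b = x), c b ^ 2) + ∑ b ∈ univ.filter (fun b => src b = x), c b ^ 2) * dirSol src tgt c B f x -
      ((∑ b ∈ univ.filter (fun b => tgt b = x), c b ^ 2 * dirSol src tgt c B f (src b)) +
        ∑ b ∈ univ.filter (fun b => src b = x), c b ^ 2 * dirSol src tgt c B f (tgt b)) = f x := by
  have hex := exists_dirSol src tgt c B w₀ hw₀0 hw₀ f
  have e : dirSol src tgt c B f = hex.choose := by rw [dirSol, dif_pos hex]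
  rw [e]
  exact hex.choose_spec.2 x hx

/-- **Uniqueness**: a function vanishing off `B` with `W·u − Nu = f` on `B` IS `dirSol B f`. [folklore] -/
theorem dirSol_unique (f u : St → ℝ) (hoff : ∀ x, x ∉ B → u x = 0)
    (hu : ∀ x ∈ B, ((∑ b ∈ univ.filter (fun b => tgt b = x), c b ^ 2) + ∑ b ∈ univ.filter (fun b => src b = x), c b ^ 2) * u x -
      ((∑ b ∈ univ.filter (fun b => tgt b = x), c b ^ 2 * u (src b)) + ∑ b ∈ univ.filter (fun b => src b = x), c b ^ 2 * u (tgt b))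
        = f x) :
    u = dirSol src tgt c B f := by
  have hd : ∀ x ∈ B, ((∑ b ∈ univ.filter (fun b => tgt b = x), c b ^ 2) + ∑ b ∈ univ.filter (fun b => src b = x), c b ^ 2) *
      (u x - dirSol src tgt c B f x) = ((∑ b ∈ univ.filter (fun b => tgt b = x), c b ^ 2 * (u (src b) - dirSol src tgt c B f (src b))) +
        ∑ b ∈ univ.filter (fun b => src b = x), c b ^ 2 * (u (tgt b) - dirSol src tgt c B f (tgt b))) := by
    intro x hx
    rw [nb_sub src tgt c u (dirSol src tgt c B f) x, mul_sub]
    have h1 := hu x hx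
    have h2 := dirSol_eq_on src tgt c B w₀ hw₀0 hw₀ f x hx
    linarith
  have hz := eq_of_harmonic_of_eq_off src tgt c B w₀ hw₀0 hw₀ (fun y => u y - dirSol src tgt c B f y) 0 hd (fun x _ => by simp)
    (fun x hx => by simp [hoff x hx, dirSol_eq_off src tgt c B w₀ hw₀0 hw₀ f x hx])
  funext x
  have := congrFun hz x
  simp only [Pi.zero_apply] at this
  linarith

/-- Finite linearity of the Dirichlet solution in the source. [folklore] -/
theorem dirSol_sum {ι : Type} (s : Finset ι) (a : ι → ℝ) (f : ι → St → ℝ) :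
    dirSol src tgt c B (fun x => ∑ i ∈ s, a i * f i x) = fun x => ∑ i ∈ s, a i * dirSol src tgt c B (f i) x := by
  symm
  refine dirSol_unique src tgt c B w₀ hw₀0 hw₀ _ _ (fun x hx => Finset.sum_eq_zero fun i _ => by
    rw [dirSol_eq_off src tgt c B w₀ hw₀0 hw₀ (f i) x hx, mul_zero]) (fun x hx => ?_)
  have h : ∀ i ∈ s, ((∑ b ∈ univ.filter (fun b => tgt b = x), c b ^ 2) + ∑ b ∈ univ.filter (fun b => src b = x), c b ^ 2) *
      (a i * dirSol src tgt c B (f i) x) - ((∑ b ∈ univ.filter (fun b => tgt b = x), c b ^ 2 * (a i * dirSol src tgt c B (f i) (src b))) +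
        ∑ b ∈ univ.filter (fun b => src b = x), c b ^ 2 * (a i * dirSol src tgt c B (f i) (tgt b))) = a i * f i x := by
    intro i _
    rw [nb_smul src tgt c (a i) (dirSol src tgt c B (f i)) x, ← dirSol_eq_on src tgt c B w₀ hw₀0 hw₀ (f i) x hx]
    ring
  rw [← Finset.sum_congr rfl h, Finset.sum_sub_distrib, Finset.mul_sum, Finset.sum_add_distrib]
  congr 1
  simp only [Finset.mul_sum]
  rw [Finset.sum_comm, Finset.sum_comm (s := univ.filter (fun b => src b = x))]

end Sol

/-! ## §2 The Green's function: positivity and comparison -/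

/-- **The DIRICHLET GREEN'S FUNCTION** `green B x z`: the value at `x` of the Dirichlet solution with the unit source at `z`
(`W·u − Nu = δ_z` on `B`, `u = 0` off `B`). MODEL object (the tree's counterpart of the expected number of visits to `z` before leaving
`B`, up to the weight normalisation). [folklore] -/
def green (B : Finset St) (x z : St) : ℝ := dirSol src tgt c B (fun w => if w = z then 1 else 0) x

section Green

variable (B : Finset St) (w₀ : St → ℝ) (hw₀0 : ∀ y, 0 ≤ w₀ y)
    (hw₀ : ∀ x ∈ B, 1 + ((∑ b ∈ univ.filter (fun b => tgt b = x), c b ^ 2 * w₀ (src b)) +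
        ∑ b ∈ univ.filter (fun b => src b = x), c b ^ 2 * w₀ (tgt b)) ≤
      ((∑ b ∈ univ.filter (fun b => tgt b = x), c b ^ 2) + ∑ b ∈ univ.filter (fun b => src b = x), c b ^ 2) * w₀ x)

include hw₀0 hw₀

/-- `green B x z = 0` for `x ∉ B`. [folklore] -/
theorem green_eq_zero_of_not_mem_left (x z : St) (hx : x ∉ B) : green src tgt c B x z = 0 :=
  dirSol_eq_off src tgt c B w₀ hw₀0 hw₀ _ x hx

/-- **COMPARISON FOR THE GREEN'S FUNCTION.**  If `w ≥ 0` off `B` and `W·w − Nw ≥ δ_z` on `B` (i.e. `≥ 1` at `z` if `z ∈ B`, `≥ 0`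
at the other sites of `B`), then `green B x z ≤ w x` for every `x` (`green(·,z) − w` is a zero-source sub-solution on `B`, nonpositive
off `B`; §1 of `GraphHarmonicExtension`). [folklore] -/
theorem green_le_of_supersolution (z : St) (w : St → ℝ) (hwoff : ∀ x, x ∉ B → 0 ≤ w x)
    (hw : ∀ x ∈ B, (if x = z then (1 : ℝ) else 0) ≤
      ((∑ b ∈ univ.filter (fun b => tgt b = x), c b ^ 2) + ∑ b ∈ univ.filter (fun b => src b = x), c b ^ 2) * w x -
        ((∑ b ∈ univ.filter (fun b => tgt b = x), c b ^ 2 * w (src b)) + ∑ b ∈ univ.filter (fun b => src b = x), c b ^ 2 * w (tgt b)))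
    (x : St) : green src tgt c B x z ≤ w x := by
  have h := nonpos_of_subsolution_unit src tgt c B w₀ hw₀0 hw₀ (fun y => green src tgt c B y z - w y) (fun y hy => ?_)
    (fun y hy => by rw [green_eq_zero_of_not_mem_left src tgt c B w₀ hw₀0 hw₀ y z hy, zero_sub, neg_nonpos]; exact hwoff y hy) x
  · linarith
  · rw [nb_sub src tgt c (fun y => green src tgt c B y z) w y, mul_sub]
    have h1 := dirSol_eq_on src tgt c B w₀ hw₀0 hw₀ (fun w => if w = z then (1 : ℝ) else 0) y hy
    have h2 := hw y hy
    simp only [green]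
    linarith

/-- `green B x z ≥ 0` (comparison of `0` with the supersolution `green(·,z)`: `−green(·,z)` is a sub-solution vanishing off `B`).
[folklore] -/
theorem green_nonneg (x z : St) : 0 ≤ green src tgt c B x z := by
  have h := nonpos_of_subsolution_unit src tgt c B w₀ hw₀0 hw₀ (fun y => -green src tgt c B y z) (fun y hy => ?_)
    (fun y hy => by rw [green_eq_zero_of_not_mem_left src tgt c B w₀ hw₀0 hw₀ y z hy, neg_zero]) x
  · linarith
  · have h1 := dirSol_eq_on src tgt c B w₀ hw₀0 hw₀ (fun w => if w = z then (1 : ℝ) else 0) y hy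
    have e := nb_smul src tgt c (-1) (fun y => green src tgt c B y z) y
    simp only [neg_one_mul] at e
    rw [e]
    have h0 : (0 : ℝ) ≤ if y = z then 1 else 0 := by positivity
    simp only [green] at h1 ⊢
    linarith

/-- An exterior pole gives the zero function: `green B x z = 0` for `z ∉ B`. [folklore] -/
theorem green_eq_zero_of_not_mem_right (x z : St) (hz : z ∉ B) : green src tgt c B x z = 0 := by
  have h : (fun _ : St => (0 : ℝ)) = dirSol src tgt c B (fun w => if w = z then 1 else 0) :=
    dirSol_unique src tgt c B w₀ hw₀0 hw₀ _ _ (fun _ _ => rfl) (fun x hx => by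
      have hxz : x ≠ z := fun h => hz (h ▸ hx)
      simp [hxz])
  have := congrFun h x
  rw [green, ← this]

end Green

/-! ## §3 LAST EXIT: the Poisson kernel through the Green's function -/

section LastExit

variable (B : Finset St) (w₀ : St → ℝ) (hw₀0 : ∀ y, 0 ≤ w₀ y)
    (hw₀ : ∀ x ∈ B, 1 + ((∑ b ∈ univ.filter (fun b => tgt b = x), c b ^ 2 * w₀ (src b)) +
        ∑ b ∈ univ.filter (fun b => src b = x), c b ^ 2 * w₀ (tgt b)) ≤
      ((∑ b ∈ univ.filter (fun b => tgt b = x), c b ^ 2) + ∑ b ∈ univ.filter (fun b => src b = x), c b ^ 2) * w₀ x)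

include hw₀0 hw₀

/-- **LAST-EXIT DECOMPOSITION.**  For `x ∈ B` and `y ∉ B`:
`poisson B x y = Σ_{z∈B} green B x z · (Nδ_y)(z)`, where `(Nδ_y)(z) = Σ_{tgt b = z, src b = y} c_b² + Σ_{src b = z, tgt b = y} c_b²` is the
total weight of the bonds joining `z` to `y` — the harmonic extension of `δ_y`, cut off outside `B`, is the Dirichlet solution with
interior source `Nδ_y` (Lawler–Limic 2010, Lemma 6.3.6's analytic content). [folklore] -/
theorem poisson_eq_sum_green (x y : St) (hx : x ∈ B) (hy : y ∉ B) :
    poisson src tgt c B x y = ∑ z ∈ B, green src tgt c B x z *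
      ((∑ b ∈ univ.filter (fun b => tgt b = z), c b ^ 2 * (if src b = y then (1 : ℝ) else 0)) +
        ∑ b ∈ univ.filter (fun b => src b = z), c b ^ 2 * (if tgt b = y then (1 : ℝ) else 0)) := by
  classical
  -- the cut-off harmonic extension `v = 1_B · harmExt B δ_y`
  set u := harmExt src tgt c B (fun w => if w = y then (1 : ℝ) else 0) with hu
  set v : St → ℝ := fun w => if w ∈ B then u w else 0 with hv
  -- the source it solves: `W·v − Nv = Nδ_y` on `B`
  have hsrc : ∀ z ∈ B, ((∑ b ∈ univ.filter (fun b => tgt b = z), c b ^ 2) + ∑ b ∈ univ.filter (fun b => src b = z), c b ^ 2) * v z -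
      ((∑ b ∈ univ.filter (fun b => tgt b = z), c b ^ 2 * v (src b)) + ∑ b ∈ univ.filter (fun b => src b = z), c b ^ 2 * v (tgt b)) =
      ((∑ b ∈ univ.filter (fun b => tgt b = z), c b ^ 2 * (if src b = y then (1 : ℝ) else 0)) +
        ∑ b ∈ univ.filter (fun b => src b = z), c b ^ 2 * (if tgt b = y then (1 : ℝ) else 0)) := by
    intro z hz
    have hh := harmExt_harmonic src tgt c B w₀ hw₀0 hw₀ (fun w => if w = y then (1 : ℝ) else 0) z hz
    have hvz : v z = u z := by simp [hv, hz]
    -- `u = v + δ_y` at every neighbour (`u = δ_y` off `B`, `v = u` on `B`, `y ∉ B`)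
    have hsplit : ∀ w : St, u w = v w + (if w = y then (1 : ℝ) else 0) := by
      intro w
      by_cases hw : w ∈ B
      · have hwy : w ≠ y := fun h => hy (h ▸ hw)
        simp [hv, hw, hwy]
      · have h2 := harmExt_eq_off src tgt c B w₀ hw₀0 hw₀ (fun w => if w = y then (1 : ℝ) else 0) w hw
        have hvw : v w = 0 := by simp [hv, hw]
        rw [hvw, zero_add]
        exact h2
    rw [hvz]
    have e1 : ∑ b ∈ univ.filter (fun b => tgt b = z), c b ^ 2 * u (src b) =
        (∑ b ∈ univ.filter (fun b => tgt b = z), c b ^ 2 * v (src b)) +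
          ∑ b ∈ univ.filter (fun b => tgt b = z), c b ^ 2 * (if src b = y then (1 : ℝ) else 0) := by
      rw [← Finset.sum_add_distrib]; exact Finset.sum_congr rfl fun b _ => by rw [hsplit (src b)]; ring
    have e2 : ∑ b ∈ univ.filter (fun b => src b = z), c b ^ 2 * u (tgt b) =
        (∑ b ∈ univ.filter (fun b => src b = z), c b ^ 2 * v (tgt b)) +
          ∑ b ∈ univ.filter (fun b => src b = z), c b ^ 2 * (if tgt b = y then (1 : ℝ) else 0) := by
      rw [← Finset.sum_add_distrib]; exact Finset.sum_congr rfl fun b _ => by rw [hsplit (tgt b)]; ring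
    rw [e1, e2] at hh
    linarith
  have hvsol := dirSol_unique src tgt c B w₀ hw₀0 hw₀ _ v (fun w hw => by simp [hv, hw]) hsrc
  -- the source as a combination of point sources, and linearity
  have hlin := dirSol_sum src tgt c B w₀ hw₀0 hw₀ B
    (fun z => (∑ b ∈ univ.filter (fun b => tgt b = z), c b ^ 2 * (if src b = y then (1 : ℝ) else 0)) +
      ∑ b ∈ univ.filter (fun b => src b = z), c b ^ 2 * (if tgt b = y then (1 : ℝ) else 0))
    (fun z w => if w = z then (1 : ℝ) else 0)
  -- the two sources agree on `B` (and `dirSol` only sees the source on `B`): rewrite through uniqueness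
  have hsame : dirSol src tgt c B (fun w => (∑ b ∈ univ.filter (fun b => tgt b = w), c b ^ 2 * (if src b = y then (1 : ℝ) else 0)) +
        ∑ b ∈ univ.filter (fun b => src b = w), c b ^ 2 * (if tgt b = y then (1 : ℝ) else 0)) =
      dirSol src tgt c B (fun w => ∑ z ∈ B, ((∑ b ∈ univ.filter (fun b => tgt b = z), c b ^ 2 * (if src b = y then (1 : ℝ) else 0)) +
        ∑ b ∈ univ.filter (fun b => src b = z), c b ^ 2 * (if tgt b = y then (1 : ℝ) else 0)) * (if w = z then (1 : ℝ) else 0)) := by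
    refine dirSol_unique src tgt c B w₀ hw₀0 hw₀ _ _ (fun w hw => dirSol_eq_off src tgt c B w₀ hw₀0 hw₀ _ w hw) (fun w hw => ?_)
    rw [dirSol_eq_on src tgt c B w₀ hw₀0 hw₀ _ w hw, Finset.sum_eq_single w]
    · simp
    · intro z _ hzw; rw [if_neg (Ne.symm hzw), mul_zero]
    · intro h; exact absurd hw h
  have hval : poisson src tgt c B x y = v x := by simp [poisson, hv, hx, hu]
  rw [hval, hvsol, hsame, hlin]
  refine Finset.sum_congr rfl fun z _ => ?_
  rw [green, mul_comm]

end LastExit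

/-! ## §4 SYMMETRY of the Green's function -/

section Symm

omit [Fintype St] in
/-- **The free Laplacian's bilinear form is symmetric**: `Σ_x u(x)·(W·v − Nv)(x) = Σ_x (W·u − Nu)(x)·v(x)` (the neighbour sums,
reindexed over the bonds, pair `u(tgt b)v(src b)` with `u(src b)v(tgt b)`). [folklore] -/
theorem sum_mul_lap_comm [Fintype St] (u v : St → ℝ) :
    ∑ x, u x * (((∑ b ∈ univ.filter (fun b => tgt b = x), c b ^ 2) + ∑ b ∈ univ.filter (fun b => src b = x), c b ^ 2) * v x -
        ((∑ b ∈ univ.filter (fun b => tgt b = x), c b ^ 2 * v (src b)) + ∑ b ∈ univ.filter (fun b => src b = x), c b ^ 2 * v (tgt b))) =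
      ∑ x, (((∑ b ∈ univ.filter (fun b => tgt b = x), c b ^ 2) + ∑ b ∈ univ.filter (fun b => src b = x), c b ^ 2) * u x -
        ((∑ b ∈ univ.filter (fun b => tgt b = x), c b ^ 2 * u (src b)) + ∑ b ∈ univ.filter (fun b => src b = x), c b ^ 2 * u (tgt b))) *
          v x := by
  classical
  -- the diagonal parts agree termwise; the neighbour parts are `Σ_b c_b²(u(tgt b)v(src b) + u(src b)v(tgt b))` on both sides
  have hT : ∀ f g : St → ℝ, ∑ x, f x * ∑ b ∈ univ.filter (fun b => tgt b = x), c b ^ 2 * g (src b) =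
      ∑ b, c b ^ 2 * (f (tgt b) * g (src b)) := by
    intro f g
    rw [← Finset.sum_fiberwise_of_maps_to (s := (univ : Finset Bd)) (t := (univ : Finset St)) (g := tgt) (fun _ _ => mem_univ _)]
    refine Finset.sum_congr rfl fun x _ => ?_
    rw [Finset.mul_sum]
    refine Finset.sum_congr rfl fun b hb => ?_
    rw [(Finset.mem_filter.mp hb).2]; ring
  have hS : ∀ f g : St → ℝ, ∑ x, f x * ∑ b ∈ univ.filter (fun b => src b = x), c b ^ 2 * g (tgt b) =
      ∑ b, c b ^ 2 * (f (src b) * g (tgt b)) := by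
    intro f g
    rw [← Finset.sum_fiberwise_of_maps_to (s := (univ : Finset Bd)) (t := (univ : Finset St)) (g := src) (fun _ _ => mem_univ _)]
    refine Finset.sum_congr rfl fun x _ => ?_
    rw [Finset.mul_sum]
    refine Finset.sum_congr rfl fun b hb => ?_
    rw [(Finset.mem_filter.mp hb).2]; ring
  have lhs : ∑ x, u x * (((∑ b ∈ univ.filter (fun b => tgt b = x), c b ^ 2) + ∑ b ∈ univ.filter (fun b => src b = x), c b ^ 2) * v x -
        ((∑ b ∈ univ.filter (fun b => tgt b = x), c b ^ 2 * v (src b)) + ∑ b ∈ univ.filter (fun b => src b = x), c b ^ 2 * v (tgt b))) =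
      (∑ x, ((∑ b ∈ univ.filter (fun b => tgt b = x), c b ^ 2) + ∑ b ∈ univ.filter (fun b => src b = x), c b ^ 2) * (u x * v x)) -
        (∑ b, c b ^ 2 * (u (tgt b) * v (src b)) + ∑ b, c b ^ 2 * (u (src b) * v (tgt b))) := by
    rw [← hT u v, ← hS u v, ← Finset.sum_add_distrib, ← Finset.sum_sub_distrib]
    exact Finset.sum_congr rfl fun x _ => by ring
  have rhs : ∑ x, (((∑ b ∈ univ.filter (fun b => tgt b = x), c b ^ 2) + ∑ b ∈ univ.filter (fun b => src b = x), c b ^ 2) * u x -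
        ((∑ b ∈ univ.filter (fun b => tgt b = x), c b ^ 2 * u (src b)) + ∑ b ∈ univ.filter (fun b => src b = x), c b ^ 2 * u (tgt b))) *
          v x =
      (∑ x, ((∑ b ∈ univ.filter (fun b => tgt b = x), c b ^ 2) + ∑ b ∈ univ.filter (fun b => src b = x), c b ^ 2) * (u x * v x)) -
        (∑ b, c b ^ 2 * (v (tgt b) * u (src b)) + ∑ b, c b ^ 2 * (v (src b) * u (tgt b))) := by
    rw [← hT v u, ← hS v u, ← Finset.sum_add_distrib, ← Finset.sum_sub_distrib]
    exact Finset.sum_congr rfl fun x _ => by ring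
  rw [lhs, rhs]
  congr 1
  rw [add_comm]
  congr 1 <;> exact Finset.sum_congr rfl fun b _ => by ring

variable (B : Finset St) (w₀ : St → ℝ) (hw₀0 : ∀ y, 0 ≤ w₀ y)
    (hw₀ : ∀ x ∈ B, 1 + ((∑ b ∈ univ.filter (fun b => tgt b = x), c b ^ 2 * w₀ (src b)) +
        ∑ b ∈ univ.filter (fun b => src b = x), c b ^ 2 * w₀ (tgt b)) ≤
      ((∑ b ∈ univ.filter (fun b => tgt b = x), c b ^ 2) + ∑ b ∈ univ.filter (fun b => src b = x), c b ^ 2) * w₀ x)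

include hw₀0 hw₀

/-- **SYMMETRY OF THE GREEN'S FUNCTION**: `green B x z = green B z x`.  Pair `u = green(·,x)` with `v = green(·,z)` in
`sum_mul_lap_comm`: off `B` both vanish, on `B` their Laplacians are `δ_x`, `δ_z`, so the two sides are `u(z)·[z ∈ B]` and
`v(x)·[x ∈ B]`; exterior poles give zero on both sides. [folklore] -/
theorem green_symm (x z : St) : green src tgt c B x z = green src tgt c B z x := by
  classical
  by_cases hx : x ∈ B
  · by_cases hz : z ∈ B
    · have key := sum_mul_lap_comm src tgt c (fun w => green src tgt c B w x) (fun w => green src tgt c B w z)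
      -- evaluate both sides
      have hl : ∑ w, green src tgt c B w x *
          (((∑ b ∈ univ.filter (fun b => tgt b = w), c b ^ 2) + ∑ b ∈ univ.filter (fun b => src b = w), c b ^ 2) *
              green src tgt c B w z -
            ((∑ b ∈ univ.filter (fun b => tgt b = w), c b ^ 2 * green src tgt c B (src b) z) +
              ∑ b ∈ univ.filter (fun b => src b = w), c b ^ 2 * green src tgt c B (tgt b) z)) = green src tgt c B z x := by
        rw [Finset.sum_eq_single z]
        · have h := dirSol_eq_on src tgt c B w₀ hw₀0 hw₀ (fun w => if w = z then (1 : ℝ) else 0) z hz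
          simp only [green] at h ⊢
          simp only [if_true] at h
          rw [h, mul_one]
        · intro w _ hwz
          by_cases hw : w ∈ B
          · have h := dirSol_eq_on src tgt c B w₀ hw₀0 hw₀ (fun w => if w = z then (1 : ℝ) else 0) w hw
            simp only [green] at h ⊢
            rw [if_neg hwz] at h
            rw [h, mul_zero]
          · rw [green_eq_zero_of_not_mem_left src tgt c B w₀ hw₀0 hw₀ w x hw, zero_mul]
        · intro h; exact absurd (mem_univ z) h
      have hr : ∑ w, (((∑ b ∈ univ.filter (fun b => tgt b = w), c b ^ 2) + ∑ b ∈ univ.filter (fun b => src b = w), c b ^ 2) *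
              green src tgt c B w x -
            ((∑ b ∈ univ.filter (fun b => tgt b = w), c b ^ 2 * green src tgt c B (src b) x) +
              ∑ b ∈ univ.filter (fun b => src b = w), c b ^ 2 * green src tgt c B (tgt b) x)) *
            green src tgt c B w z = green src tgt c B x z := by
        rw [Finset.sum_eq_single x]
        · have h := dirSol_eq_on src tgt c B w₀ hw₀0 hw₀ (fun w => if w = x then (1 : ℝ) else 0) x hx
          simp only [green] at h ⊢
          simp only [if_true] at h
          rw [h, one_mul]
        · intro w _ hwx
          by_cases hw : w ∈ B
          · have h := dirSol_eq_on src tgt c B w₀ hw₀0 hw₀ (fun w => if w = x then (1 : ℝ) else 0) w hw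
            simp only [green] at h ⊢
            rw [if_neg hwx] at h
            rw [h, zero_mul]
          · rw [green_eq_zero_of_not_mem_left src tgt c B w₀ hw₀0 hw₀ w z hw, mul_zero]
        · intro h; exact absurd (mem_univ x) h
      rw [hl, hr] at key
      exact key.symm
    · rw [green_eq_zero_of_not_mem_right src tgt c B w₀ hw₀0 hw₀ x z hz,
        green_eq_zero_of_not_mem_left src tgt c B w₀ hw₀0 hw₀ z x hz]
  · rw [green_eq_zero_of_not_mem_left src tgt c B w₀ hw₀0 hw₀ x z hx,
      green_eq_zero_of_not_mem_right src tgt c B w₀ hw₀0 hw₀ z x hx]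

/-- **LAST EXIT WITH THE POLE AT THE EVALUATION POINT** (symmetry applied): for `x ∈ B`, `y ∉ B`,
`poisson B x y = Σ_{z∈B} green B z x · (Nδ_y)(z)` — the Poisson kernel from `x` is read off the Green's function WITH POLE AT `x`,
the object an explicit supersolution around `x` controls. [folklore] -/
theorem poisson_eq_sum_green_pole (x y : St) (hx : x ∈ B) (hy : y ∉ B) :
    poisson src tgt c B x y = ∑ z ∈ B, green src tgt c B z x *
      ((∑ b ∈ univ.filter (fun b => tgt b = z), c b ^ 2 * (if src b = y then (1 : ℝ) else 0)) +
        ∑ b ∈ univ.filter (fun b => src b = z), c b ^ 2 * (if tgt b = y then (1 : ℝ) else 0)) := by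
  rw [poisson_eq_sum_green src tgt c B w₀ hw₀0 hw₀ x y hx hy]
  exact Finset.sum_congr rfl fun z _ => by rw [green_symm src tgt c B w₀ hw₀0 hw₀ x z]

end Symm

end

end Summit.QuantumFields.BalabanUV.Beta.GraphGreenFunction
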